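import Mathlib.MeasureTheory.Constructions.HaarToSphere
import Literature.MathematicalPhysics.QuantumFieldTheory.ShenZhuZhuPoincareApplications
import HarnessLib

/-!
# Shen–Zhu–Zhu 2024: Langevin dynamics of lattice Yang–Mills–Higgs — the explicit strong-coupling
# conditions and the mass-gap / uniqueness / large-`N` theorems (arXiv:2401.13299), `G = SO(N)`

H. Shen, R. Zhu, X. Zhu, *Langevin dynamics of lattice Yang–Mills–Higgs and applications*,
arXiv:2401.13299 [ShenZhuZhu2024Langevin] (the sequel of CMP 400 (2023) 805 = [ShenZhuZhuCMP2023],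
whose pure Yang–Mills content the tree holds as `shen_zhu_zhu`, `szzBakryEmeryConstSU/SO`,
`SZZExponentialClustering`, `shenZhuZhu_largeN_variance`, …). R141 (D) cross-ladder literature
typing, item (4) residual (b). STATEMENTS ONLY: every theorem of the source is a closed named `Prop`
(not proved here); every object is a definition with a body; nothing here is a claim about the
Yang–Mills mass gap.

## The source (numbers of arXiv v2; inside §§3–6 the environments carry no numbers in the held text,
## so they are cited by section and printed label/condition)

Setting (§2.1): structure group `G = SO(N)`, "`N > 2`", torus `Λ_L = ℤ^d ∩ L𝕋^d` (periodic b.c.),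
Yang–Mills field `Q ∈ G^{E⁺_Λ}`, Higgs field `Φ ∈ M^Λ` with `M ∈ {ℝ^N, 𝕊^{N-1}, G}` (cases (1)–(3)),
action (2.x) `𝒮_YMH(Q,Φ) = Nβ Σ_{p∈𝒫⁺_Λ} Re Tr Q_p − Nκ Σ_{e=(x,y)∈E⁺_Λ} |Q_e Φ_y − Φ_x|² − mN Σ_z |Φ_z|²`
(the mass term is a constant and dropped for `𝕊^{N-1}` and `G`; `|·|` Euclidean on `ℝ^N ⊇ 𝕊^{N-1}`,
Hilbert–Schmidt `Tr(AAᵗ)` on `G ⊆ M_N(ℝ)`; the `G`-action on `M = G` is LEFT multiplication, case (3)),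
Gibbs measure `dμ_Λ = Z⁻¹ exp(𝒮_YMH) Π_e dσ_N(Q_e) Π_z dΦ_z` with `σ_N` = Haar, `dΦ_z` = Lebesgue /
uniform / Haar measure on `M`; "infinite volume limit `μ` of `μ_Λ`" = tight (weak) limit of the
periodic extensions as `Λ ↑ ℤ^d`.

* Theorem 1.2 (`M = ℝ^N`, `m, κ > 0`, `N > 2`): if `8(d-1)|β| + κ/m + 2κ²/m² < 1/4 − 1/(2N)` then
  `μ_Λ` satisfies Poincaré inequalities uniformly in `Λ`, every infinite volume limit `μ` satisfies the
  Poincaré inequality, and the infinite-volume dynamic is exponentially ergodic in `L²(μ)` (precise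
  forms: §4.1 Theorem "Poincaré inequality for `μ_Λ`" and its Corollary). §5.1 Theorem (mass gap for
  `M = ℝ^N`): with `K_𝒮 = (N+2)/4 − 1 − κN/m − 2κ²N/m² − 8(d-1)N|β| > 0` (the same condition multiplied
  by `N`), for cylinder `F, H` with `Λ_F ∩ Λ_H = ∅` and every infinite volume limit `μ`,
  `|Cov_μ(F,H)| ≤ c₁ e^{−c_N d(Λ_F,Λ_H)} (⦀F⦀₂⦀H⦀₂ + ‖F‖_{L²}‖H‖_{L²})`, `c₁ = c₁(|Λ_F|,|Λ_H|,N)`,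
  `c_N = c_N(K_𝒮,N,d)`, `⦀F⦀₂ = Σ_e ‖∇_eF‖_{L²(μ)} + Σ_x ‖∇_xF‖_{L²(μ)}`.
* Theorem 1.3 / §4.2 (`M = 𝕊^{N-1}` or `G`; no sign condition on `κ`, no `m`): if for some `δ > 0`
  (KS-S) `K_𝒮 := min{(N+2)/4 − 1 − 8(d-1)|β|N − 2(2δ+1)|κ|N, (N−2) − 4|κ|N d(2+1/δ)} > 0` resp.
  (KS-G) `K_𝒮 := min{(N+2)/4 − 1 − 8(d-1)|β|N − 2|κ|N(1+2δ), (N+2)/4 − 1 − 4|κ|N d(2+1/δ)} > 0`, then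
  log-Sobolev and Poincaré inequalities hold for `μ_Λ` with constant `K_𝒮`, and (§4.2 Corollary) the
  invariant measure of the infinite-volume dynamics is UNIQUE, "in particular, any infinite volume
  limit of `μ_Λ` is `μ`", with exponential ergodicity in `L^∞(μ)`.
* Theorem 1.4 / §5.2 Theorem (mass gap, `M = 𝕊^{N-1}` or `G`, under (KS-S) resp. (KS-G)): for cylinder
  `F, H` with `Λ_F ∩ Λ_H = ∅`, for the unique infinite volume limit `μ`,
  `|Cov_μ(F,H)| ≤ c₁ (d(𝔤)+N−1) e^{−c_N d(Λ_F,Λ_H)} (⦀F⦀_∞⦀H⦀_∞ + ‖F‖_{L²}‖H‖_{L²})`.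
* §5.3 (improved condition for `M = G` by U-gauge fixing): the gauge `g_x = Φ_x⁻¹` turns `μ_Λ` — on
  gauge-invariant observables — into the pure link measure `ν_Λ ∝ exp(Nβ Σ_p Re Tr Q_p + 2κN Σ_e Tr Q_e) Π dσ_N`
  (Lemma: `𝐄_{μ_Λ}(h) = 𝐄_{ν_Λ}(h(·, Id))` for gauge-invariant `h`); Lemma: if
  `K_{𝒮'} := (N+2)/4 − 1 − N(8(d-1)|β| + 2|κ|) > 0` then log-Sobolev/Poincaré for `ν_Λ`; Corollary:
  under `K_{𝒮'} > 0`, for GAUGE-INVARIANT cylinder `F, G` with disjoint supports and ANY infinite volume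
  limit `μ`, the same exponential clustering bound.
* §6 Theorem (large `N`, `M ∈ {𝕊^{N-1}, G}`): under (KS-S), for the unique `μ` and every Wilson loop
  `W_l = Tr(Q_{e₁}⋯Q_{e_n})`, `Var_μ(W_l/N) ≤ n(n−3)/(K_𝒮 N)`; under `K_{𝒮'} > 0` (`M = G`), for every
  infinite volume limit and every Wilson loop OR Wilson line `W_l = Tr(Φ_{u}ᵗ Q_{e₁}⋯Q_{e_n} Φ_v)`,
  `Var_μ(W_l/N) ≤ n(n−3)/(K_{𝒮'} N)`; hence convergence in probability and factorisation as `N → ∞`.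

## What is typed here, and how (tree vocabulary; FLAGS)

* §A The four explicit Bakry–Émery constants as real-valued definitions `szz24ConstRN`,
  `szz24ConstSphere`, `szz24ConstGroup`, `szz24ConstUGauge`, with the PROVED equivalences
  `szz24ConstRN_pos_iff` (`K_𝒮 > 0 ↔` the displayed condition of Theorem 1.2) and
  `szz24ConstUGauge_pos_iff`.
* §B The lattice YMH model for `G = SO(N) = Matrix.specialOrthogonalGroup (Fin N) ℝ` (tree instances
  via `Matrix.specialUnitaryGroup _ ℝ`), GENERIC in the Higgs target: parameters `(refM, act, sqDist,
  massFn)` — reference measure on `M`, `G`-action, squared distance of the kinetic term, mass density —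
  with the three printed instantiations `rn*` (`M = ℝ^N = EuclideanSpace ℝ (Fin N)`, Lebesgue,
  `Q·v`, `‖v−w‖²`, `‖v‖²`), `sphere*` (SAME carrier `ℝ^N` with the uniform measure of the unit sphere
  pushed into `ℝ^N` as reference measure — FLAG (S): the sphere constraint is carried by the reference
  measure `(volume.toSphere).map Subtype.val`, a measure-theoretically identical rendering of
  "`Φ_z ∈ 𝕊^{N-1}`, `dΦ_z` uniform", chosen so that the `SO(N)`-action needs no norm-preservation proof
  inside a definition; mass term `0`), `grp*` (`M = G`, Haar, left multiplication, `Tr((A−B)(A−B)ᵗ)`,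
  mass `0`). Torus objects: `ymhAction`, `ymhWeight`, `ymhMeasure` on
  `GaugeConfig d L G × (Site d L → M)` (Wave 0's torus `(ℤ/L)^d`; `Plaquette d L` = `𝒫⁺_Λ`, `Edge d L` =
  `E⁺_Λ`, edge `(x,i)` runs from `x` to `x+eᵢ`); `ℤ^d` objects: `YMHConfig`, `ymhTorusLift`,
  `IsYMHCylinder`, `IsYMHLimitAlong` / `ymhLimitPoints` (FLAG (L): "infinite volume (tight) limit" is
  rendered, as the tree's `infiniteVolumeLimitPoints`, by convergence of the periodic states on bounded
  continuous cylinder functions along a subsequence of tori `L_k + 1 → ∞`), `ymhGaugeTransformZd` /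
  `IsYMHGaugeInvariant`, and the U-gauge link measure `uGaugeMeasure` of §5.3.
* §C Observables: `IsYMHLipschitzCylinder` (FLAG (D): SZZ's smooth cylinder functions with the
  seminorms `⦀F⦀_∞ = Σ‖∇F‖_∞` resp. `⦀F⦀₂` are rendered, exactly as in the tree's `shen_zhu_zhu`, by
  cylinder functions that are `K`-Lipschitz functions of the matrix entries of the links in `S` and of
  the Higgs coordinates in `T` — sup metric on coordinates; since `‖∇F‖ ≤ K√(#coords)` for such `F`,
  the printed bounds give the typed ones with `c₁` depending on the support size `n`, which is how `c₁`
  is quantified (`∀ n ∃ c₁`); boundedness of `F` is assumed in addition (harmless for compact targets,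
  a restriction for `ℝ^N`) — so each typed clustering statement is implied by the printed one);
  `ymhSupportDist` (FLAG (M): `ℓ^∞` distance between the vertex sets `{base points of S} ∪ T`, for SZZ's
  graph distance `d(Λ_F,Λ_H)`; since the `ℓ^∞` distance is the smaller one, the typed decay
  `e^{−c·ℓ^∞}` is implied by the printed `e^{−c·d(Λ_F,Λ_H)}` with the same rate); `YMHClustersExp`
  (the common conclusion shape); Wilson loop / line variables `soWilsonLoopTrace`, `grpWilsonLine`.
* §D The named facts (one per printed statement; the two compact targets are the two conjuncts):
  `szz24_uniqueness` (§4.2 Corollary, as "at most one infinite-volume limit point"),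
  `szz24_massGap_compact` (§5.2 Theorem), `szz24_massGap_rn` (§5.1 Theorem), `szz24_uGauge_expectation`
  (§5.3 Lemma, the gauge-fixing identity on the torus), `szz24_uGauge_massGap` (§5.3 Corollary),
  `szz24_largeN_variance` (§6 Theorem, Wilson loops).
  Throughout `d ≥ 2` and `N ≥ 3` ("`N > 2`").
* NOT typed: Theorem 1.1 (global well-posedness / invariance of the SDEs (3.x)), the log-Sobolev and
  Poincaré inequalities themselves and the ergodicity rates (they need the Dirichlet forms of the
  product manifolds `G^{E} × M^{Λ}`; the tree's `LatticeLangevinDynamics` / `langevinDirichletForm`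
  cover links only), the convergence-in-probability and factorisation clauses of §6 (Chebyshev /
  induction consequences of the variance bounds, as for `shenZhuZhu_largeN_variance`) and the Wilson-LINE
  clause of the §6 variance bound (GAP-STATED in the docstring of `szz24_largeN_variance`: the
  printed right-hand side `n(n−3)/(K_{𝒮'}N)` is non-positive for lines with `n ≤ 3` edges), Remark (other
  groups `SU(N)`, `Sp(N)` and targets (4)–(6)), and the `ℝ^N` Poincaré constant of §4.1 (printed only
  implicitly through (4.x)).

## References

* H. Shen, R. Zhu, X. Zhu, *Langevin dynamics of lattice Yang–Mills–Higgs and applications*,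
  arXiv:2401.13299v2 (2024): §1 Theorems 1.1–1.4; §2.1 (model, cases (1)–(3), gauge transformations,
  Wilson loops and lines); §4.1 (Theorem: Poincaré for `M = ℝ^N`; Corollary: `L²`-ergodicity); §4.2
  (Lemmas with conditions (KS-S), (KS-G); Corollary: uniqueness and `L^∞`-ergodicity); §5.1 (Theorem:
  mass gap, `M = ℝ^N`); §5.2 (Theorem: mass gap, `M ∈ {𝕊^{N-1}, G}`); §5.3 (Lemma: U-gauge identity;
  Lemma: `K_{𝒮'}`; Corollary: mass gap for gauge-invariant observables); §6 (Theorem: large `N`)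
  [ShenZhuZhu2024Langevin].
* H. Shen, R. Zhu, X. Zhu, CMP 400 (2023) 805–851 = arXiv:2204.12737 [ShenZhuZhuCMP2023] — the pure
  Yang–Mills case (`κ = 0`): tree `shen_zhu_zhu`, `szzBakryEmeryConstSO`, `shenZhuZhu_largeN_variance`.
* E. Seiler, *Gauge Theories as a Problem of Constructive Quantum Field Theory and Statistical
  Mechanics*, LNP 159 (1982) — U-gauge and "complete breakdown of symmetry" (SZZ's [Seiler]).
-/

noncomputable section

open MeasureTheory ProbabilityTheory Filter Topology
open scoped NNReal
open Literature.MathematicalPhysics.QuantumLattice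
open Literature.Probability.LatticeModels (zdGraph)
open Literature.MathematicalPhysics.QuantumFieldTheory.Balaban1983to89.TraceWordsSeparateOrbitsOrthogonal
  (specialOrthogonalRep)

namespace Literature.MathematicalPhysics.QuantumFieldTheory

/-! ## §A The explicit Bakry–Émery constants (the NUMBERS of the paper) -/

/-- **The constant of Theorem 1.2 / §5.1** (`M = ℝ^N`, `m, κ > 0`):
`K_𝒮 = (N+2)/4 − 1 − κN/m − 2κ²N/m² − 8(d−1)N|β|` (§5.1 Theorem, mass gap for `M = ℝ^N`). Its
positivity is Theorem 1.2's displayed condition `8(d−1)|β| + κ/m + 2κ²/m² < 1/4 − 1/(2N)` multiplied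
by `N` (`szz24ConstRN_pos_iff`). The terms: Ricci curvature `(N+2)/4 − 1` of `SO(N)` for the
Hilbert–Schmidt metric, the pure Yang–Mills Hessian bound `8(d−1)N|β|` of [ShenZhuZhuCMP2023]
Lemma 4.1, and the Higgs contributions after integrating out `Φ` (§4.1).
[cite: ShenZhuZhu2024Langevin, Thm 1.2 and §5.1 Theorem (mass gap for M = ℝ^N), definition of K_𝒮] -/
def szz24ConstRN (N d : ℕ) (β κ m : ℝ) : ℝ :=
  ((N : ℝ) + 2) / 4 - 1 - κ * N / m - 2 * κ ^ 2 * N / m ^ 2 - 8 * ((d : ℝ) - 1) * N * |β|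

/-- **The constant (KS-S) of §4.2** (`M = 𝕊^{N−1}`), for an auxiliary `δ > 0`:
`K_𝒮 = min{(N+2)/4 − 1 − 8(d−1)|β|N − 2(2δ+1)|κ|N, (N−2) − 4|κ|N d (2 + 1/δ)}` — the first entry from
the link directions (Ricci `(N+2)/4 − 1`), the second from the Higgs directions (Ricci `N − 2` of the
unit sphere), `δ` from Young's inequality in the Hessian bound (4.x) of the kinetic term.
[cite: ShenZhuZhu2024Langevin, §4.2 Lemma (log-Sobolev for Φ_x ∈ 𝕊^{N-1}), condition (KS-S); Thm 1.3] -/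
def szz24ConstSphere (N d : ℕ) (β κ δ : ℝ) : ℝ :=
  min (((N : ℝ) + 2) / 4 - 1 - 8 * ((d : ℝ) - 1) * |β| * N - 2 * (2 * δ + 1) * |κ| * N)
    (((N : ℝ) - 2) - 4 * |κ| * N * d * (2 + 1 / δ))

/-- **The constant (KS-G) of §4.2** (`M = G = SO(N)`, left multiplication), for `δ > 0`:
`K_𝒮 = min{(N+2)/4 − 1 − 8(d−1)|β|N − 2|κ|N(1+2δ), (N+2)/4 − 1 − 4|κ|N d(2+1/δ)}`.
[cite: ShenZhuZhu2024Langevin, §4.2 Lemma (log-Sobolev for Φ_x ∈ G), condition (KS-G); Thm 1.3] -/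
def szz24ConstGroup (N d : ℕ) (β κ δ : ℝ) : ℝ :=
  min (((N : ℝ) + 2) / 4 - 1 - 8 * ((d : ℝ) - 1) * |β| * N - 2 * |κ| * N * (1 + 2 * δ))
    (((N : ℝ) + 2) / 4 - 1 - 4 * |κ| * N * d * (2 + 1 / δ))

/-- **The improved constant of §5.3** (`M = G`, after U-gauge fixing):
`K_{𝒮'} = (N+2)/4 − 1 − N(8(d−1)|β| + 2|κ|)` (Hessian of the gauge-fixed action
`𝒮' = Nβ Σ_p Re Tr Q_p + 2κN Σ_e Tr Q_e`: `|Hess_{𝒮₂'}(v,v)| ≤ 2|κ|N|v|²`).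
[cite: ShenZhuZhu2024Langevin, §5.3 Lemma (log-Sobolev and Poincaré for ν_Λ), definition of K_{𝒮'}] -/
def szz24ConstUGauge (N d : ℕ) (β κ : ℝ) : ℝ :=
  ((N : ℝ) + 2) / 4 - 1 - N * (8 * ((d : ℝ) - 1) * |β| + 2 * |κ|)

/-- **Theorem 1.2's displayed condition is `K_𝒮 > 0`**: for `N ≥ 1` and `m > 0`,
`szz24ConstRN N d β κ m > 0 ↔ 8(d−1)|β| + κ/m + 2κ²/m² < 1/4 − 1/(2N)` (divide by `N`).
[cite: ShenZhuZhu2024Langevin, Thm 1.2 (displayed condition) with §5.1 Theorem (K_𝒮)] -/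
theorem szz24ConstRN_pos_iff {N d : ℕ} (hN : 1 ≤ N) {m : ℝ} (hm : 0 < m) (β κ : ℝ) :
    0 < szz24ConstRN N d β κ m ↔
      8 * ((d : ℝ) - 1) * |β| + κ / m + 2 * κ ^ 2 / m ^ 2 < 1 / 4 - 1 / (2 * N) := by
  have hN' : (0 : ℝ) < N := by exact_mod_cast hN
  have key : szz24ConstRN N d β κ m =
      N * ((1 / 4 - 1 / (2 * N)) - (8 * ((d : ℝ) - 1) * |β| + κ / m + 2 * κ ^ 2 / m ^ 2)) := by
    unfold szz24ConstRN
    field_simp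
    ring
  rw [key]
  constructor
  · intro h
    have := (mul_pos_iff_of_pos_left hN').1 h
    linarith
  · intro h
    exact mul_pos hN' (by linarith)

/-- `K_{𝒮'} > 0 ↔ 8(d−1)|β| + 2|κ| < 1/4 − 1/(2N)` (`N ≥ 1`): the U-gauge condition in the normalised
form of Theorem 1.2's display. [cite: ShenZhuZhu2024Langevin, §5.3 Lemma (K_{𝒮'} > 0)] -/
theorem szz24ConstUGauge_pos_iff {N d : ℕ} (hN : 1 ≤ N) (β κ : ℝ) :
    0 < szz24ConstUGauge N d β κ ↔ 8 * ((d : ℝ) - 1) * |β| + 2 * |κ| < 1 / 4 - 1 / (2 * N) := by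
  have hN' : (0 : ℝ) < N := by exact_mod_cast hN
  have key : szz24ConstUGauge N d β κ =
      N * ((1 / 4 - 1 / (2 * N)) - (8 * ((d : ℝ) - 1) * |β| + 2 * |κ|)) := by
    unfold szz24ConstUGauge
    field_simp
    ring
  rw [key]
  constructor
  · intro h
    have := (mul_pos_iff_of_pos_left hN').1 h
    linarith
  · intro h
    exact mul_pos hN' (by linarith)

/-- At `κ = 0` the U-gauge constant is the pure Yang–Mills constant of [ShenZhuZhuCMP2023] for `SO(N)`
(tree `szzBakryEmeryConstSO`). [cite: ShenZhuZhu2024Langevin, §5.3 (K_{𝒮'} at κ = 0)] -/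
theorem szz24ConstUGauge_zero (N d : ℕ) (β : ℝ) :
    szz24ConstUGauge N d β 0 = szzBakryEmeryConstSO N d β := by
  simp [szz24ConstUGauge, szzBakryEmeryConstSO]
  ring

/-! ## §B The lattice Yang–Mills–Higgs model for `G = SO(N)` -/

section Model

variable {d L N : ℕ} {M : Type*}

/-- **The lattice YMH action** (§2.1, (2.x) `𝒮_YMH`) on the torus `Λ_L = (ℤ/L)^d` for `G = SO(N)`,
generic in the Higgs target `M` through the `G`-action `act`, the squared distance `sqDist` of the
kinetic term and the mass density `massFn`:
`𝒮(Q,Φ) = Nβ Σ_{p ∈ 𝒫⁺} Tr Q_p − Nκ Σ_{e=(x,x+eᵢ)} sqDist(Q_e Φ_{x+eᵢ}, Φ_x) − Nm Σ_x massFn(Φ_x)`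
(`Re Tr = Tr` for real matrices). [cite: ShenZhuZhu2024Langevin, §2.1 (the action 𝒮_YMH, (2.x))] -/
def ymhAction [NeZero L] (act : Matrix.specialOrthogonalGroup (Fin N) ℝ → M → M)
    (sqDist : M → M → ℝ) (massFn : M → ℝ) (β κ m : ℝ)
    (c : GaugeConfig d L (Matrix.specialOrthogonalGroup (Fin N) ℝ) × (Site d L → M)) : ℝ :=
  N * β * ∑ p : Plaquette d L,
      ((plaquetteHolonomy c.1 p.1 p.2.1.1 p.2.1.2 : Matrix.specialOrthogonalGroup (Fin N) ℝ) :
        Matrix (Fin N) (Fin N) ℝ).trace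
    - N * κ * ∑ e : Edge d L, sqDist (act (c.1 e) (c.2 (e.1.shift e.2))) (c.2 e.1)
    - N * m * ∑ x : Site d L, massFn (c.2 x)

variable [MeasurableSpace M]

/-- The un-normalised YMH weight `exp(𝒮_YMH(Q,Φ)) Π_e dσ_N(Q_e) Π_z dΦ_z` on torus configurations
(`σ_N` = normalised Haar measure of `SO(N)`, `dΦ_z = refM`). A junk value (possibly an infinite
measure) when the weight is not integrable, e.g. `M = ℝ^N` with `m ≤ 0`.
[cite: ShenZhuZhu2024Langevin, §2.1 (the measure μ_{Λ,N,β,κ,m})] -/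
def ymhWeight [NeZero L] (refM : Measure M) (act : Matrix.specialOrthogonalGroup (Fin N) ℝ → M → M)
    (sqDist : M → M → ℝ) (massFn : M → ℝ) (β κ m : ℝ) :
    Measure (GaugeConfig d L (Matrix.specialOrthogonalGroup (Fin N) ℝ) × (Site d L → M)) :=
  ((Measure.pi fun _ : Edge d L => haarProbability (Matrix.specialOrthogonalGroup (Fin N) ℝ)).prod
      (Measure.pi fun _ : Site d L => refM)).withDensity
    fun c => ENNReal.ofReal (Real.exp (ymhAction act sqDist massFn β κ m c))

/-- **The lattice YMH probability measure** `μ_Λ = Z_Λ⁻¹ exp(𝒮_YMH) Π dσ_N(Q_e) Π dΦ_z` on the torus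
`Λ_L` (§2.1), generic in the target data. [cite: ShenZhuZhu2024Langevin, §2.1 (μ_Λ = μ_{Λ,N,β,κ,m})] -/
def ymhMeasure [NeZero L] (refM : Measure M) (act : Matrix.specialOrthogonalGroup (Fin N) ℝ → M → M)
    (sqDist : M → M → ℝ) (massFn : M → ℝ) (β κ m : ℝ) :
    Measure (GaugeConfig d L (Matrix.specialOrthogonalGroup (Fin N) ℝ) × (Site d L → M)) :=
  (ymhWeight (d := d) (L := L) refM act sqDist massFn β κ m Set.univ)⁻¹ •
    ymhWeight refM act sqDist massFn β κ m

variable (d N M) in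
/-- Infinite-volume YMH configurations on `ℤ^d`: links `Q : E⁺(ℤ^d) → SO(N)` (tree `LGConfig`) and
Higgs field `Φ : ℤ^d → M` (SZZ's `𝒬 = G^{E⁺} × M^{ℤ^d}`, §3.2).
[cite: ShenZhuZhu2024Langevin, §3.2 (infinite-volume state space)] -/
abbrev YMHConfig : Type _ :=
  LGConfig d (Matrix.specialOrthogonalGroup (Fin N) ℝ) × (Literature.Probability.LatticeModels.Site d → M)

/-- The periodic extension of a torus YMH configuration to `ℤ^d` (links through the tree's
`torusLift`, Higgs field through `Torus.proj`). [cite: ShenZhuZhu2024Langevin, §3.2 (periodic extension of μ_Λ)] -/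
def ymhTorusLift (L : ℕ) (c : GaugeConfig d L (Matrix.specialOrthogonalGroup (Fin N) ℝ) × (Site d L → M)) :
    YMHConfig d N M :=
  (torusLift L c.1, fun x => c.2 (Literature.Probability.LatticeModels.Torus.proj L x))

/-- A cylinder function of the YMH configuration with link support `S` and site support `T`: it
depends only on the links in `S` and the Higgs variables in `T` (SZZ's `Λ_F` = "the set of the edges
and points `F` depends on"). [cite: ShenZhuZhu2024Langevin, §5.1 (Λ_F, cylinder functions C^∞_cyl)] -/
def IsYMHCylinder {α : Type*} (F : YMHConfig d N M → α) (S : Finset (ZdEdge d))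
    (T : Finset (Literature.Probability.LatticeModels.Site d)) : Prop :=
  ∀ c c' : YMHConfig d N M, (∀ e ∈ S, c.1 e = c'.1 e) → (∀ x ∈ T, c.2 x = c'.2 x) → F c = F c'

variable [TopologicalSpace M]

/-- `μ` is an infinite-volume limit of the YMH torus states along the torus sizes `L_k + 1`: a
probability measure on `YMHConfig d N M` to which the periodic states converge on every bounded
continuous cylinder function (FLAG (L) of the module docstring: SZZ's "tight limit of the periodic
extensions"). [cite: ShenZhuZhu2024Langevin, §3.2 and §4 ("infinite volume limit μ of μ_Λ")] -/
def IsYMHLimitAlong (refM : Measure M) (act : Matrix.specialOrthogonalGroup (Fin N) ℝ → M → M)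
    (sqDist : M → M → ℝ) (massFn : M → ℝ) (β κ m : ℝ) (Lseq : ℕ → ℕ)
    (μ : Measure (YMHConfig d N M)) : Prop :=
  IsProbabilityMeasure μ ∧
    ∀ (F : YMHConfig d N M → ℝ) (S : Finset (ZdEdge d))
      (T : Finset (Literature.Probability.LatticeModels.Site d)),
      IsYMHCylinder F S T → Continuous F → (∃ C, ∀ c, |F c| ≤ C) →
        Tendsto (fun k : ℕ =>
            ∫ c, F (ymhTorusLift (Lseq k + 1) c)
              ∂(ymhMeasure (d := d) (L := Lseq k + 1) refM act sqDist massFn β κ m))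
          atTop (𝓝 (∫ c, F c ∂μ))

/-- The set of infinite-volume limit points of the YMH torus states (subsequential limits
`L_k + 1 → ∞`). [cite: ShenZhuZhu2024Langevin, §4 ("any infinite volume limit μ of μ_Λ")] -/
def ymhLimitPoints (refM : Measure M) (act : Matrix.specialOrthogonalGroup (Fin N) ℝ → M → M)
    (sqDist : M → M → ℝ) (massFn : M → ℝ) (β κ m : ℝ) : Set (Measure (YMHConfig d N M)) :=
  {μ | ∃ Lseq : ℕ → ℕ, StrictMono Lseq ∧ IsYMHLimitAlong (d := d) refM act sqDist massFn β κ m Lseq μ}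

/-- Gauge transformation of an infinite-volume YMH configuration by `g : ℤ^d → G`:
`Q_{(x,i)} ↦ g_x Q_{(x,i)} g_{x+eᵢ}⁻¹` (tree `gaugeTransformZd`), `Φ_x ↦ g_x · Φ_x` ((2.x), cases
(1)–(3)). [cite: ShenZhuZhu2024Langevin, §2.1 (gauge transformations)] -/
def ymhGaugeTransformZd (act : Matrix.specialOrthogonalGroup (Fin N) ℝ → M → M)
    (g : Literature.Probability.LatticeModels.Site d → Matrix.specialOrthogonalGroup (Fin N) ℝ)
    (c : YMHConfig d N M) : YMHConfig d N M :=
  (gaugeTransformZd g c.1, fun x => act (g x) (c.2 x))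

/-- A gauge-invariant observable of the infinite-volume YMH configuration.
[cite: ShenZhuZhu2024Langevin, §2.1 (gauge invariant observables)] -/
def IsYMHGaugeInvariant {α : Type*} (act : Matrix.specialOrthogonalGroup (Fin N) ℝ → M → M)
    (F : YMHConfig d N M → α) : Prop :=
  ∀ g c, F (ymhGaugeTransformZd act g c) = F c

end Model

/-! ### The three Higgs targets of cases (1)–(3) -/

section Targets

variable {N : ℕ}

/-- Case (1)/(2): the defining action of `SO(N)` on `ℝ^N` (matrix times vector).
[cite: ShenZhuZhu2024Langevin, §2.1 case (1)] -/
def rnAct (Q : Matrix.specialOrthogonalGroup (Fin N) ℝ) (v : EuclideanSpace ℝ (Fin N)) :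
    EuclideanSpace ℝ (Fin N) :=
  Matrix.toEuclideanLin (Q : Matrix (Fin N) (Fin N) ℝ) v

/-- Case (1)/(2): the kinetic term `|Q_e Φ_y − Φ_x|²_{ℝ^N}`. [cite: ShenZhuZhu2024Langevin, §2.1 cases (1)–(2)] -/
def rnSqDist (v w : EuclideanSpace ℝ (Fin N)) : ℝ := ‖v - w‖ ^ 2

/-- Case (1): the mass density `|Φ_z|²`. [cite: ShenZhuZhu2024Langevin, §2.1 case (1)] -/
def rnMass (v : EuclideanSpace ℝ (Fin N)) : ℝ := ‖v‖ ^ 2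

variable (N) in
/-- Case (2): the uniform measure of the unit sphere `𝕊^{N−1} ⊆ ℝ^N`, as a measure on `ℝ^N`
(Mathlib's `Measure.toSphere` of Lebesgue measure, pushed forward along the inclusion; its
normalisation is immaterial for the Gibbs measure). FLAG (S) of the module docstring.
[cite: ShenZhuZhu2024Langevin, §2.1 case (2) ("dΦ_z" uniform on 𝕊^{N-1})] -/
def sphereRef : Measure (EuclideanSpace ℝ (Fin N)) :=
  ((volume : Measure (EuclideanSpace ℝ (Fin N))).toSphere).map Subtype.val

/-- Case (3): the action of `G` on `M = G` by left multiplication. [cite: ShenZhuZhu2024Langevin, §2.1 case (3)] -/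
def grpAct (Q Φ : Matrix.specialOrthogonalGroup (Fin N) ℝ) : Matrix.specialOrthogonalGroup (Fin N) ℝ :=
  Q * Φ

/-- Case (3): the Hilbert–Schmidt kinetic term `|Q_e Φ_y − Φ_x|² = Tr((Q_eΦ_y − Φ_x)(Q_eΦ_y − Φ_x)ᵗ)`
((2.x), "`(e:rev-e)`"). [cite: ShenZhuZhu2024Langevin, §2.1 case (3) and (2.x) (e:HS)] -/
def grpSqDist (A B : Matrix.specialOrthogonalGroup (Fin N) ℝ) : ℝ :=
  (((A : Matrix (Fin N) (Fin N) ℝ) - B) * ((A : Matrix (Fin N) (Fin N) ℝ) - B).transpose).trace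

/-- The coordinates of a group-valued Higgs variable: its matrix entries (for the Lipschitz
rendering of cylinder observables, FLAG (D)). [folklore] -/
def grpCoord (Φ : Matrix.specialOrthogonalGroup (Fin N) ℝ) : Fin N → Fin N → ℝ :=
  fun i j => (Φ : Matrix (Fin N) (Fin N) ℝ) i j

end Targets

/-! ### The three models' limit-point sets (abbreviations of `ymhLimitPoints`) -/

section ModelInstances

variable (d N : ℕ)

/-- Infinite-volume limit points of the `ℝ^N`-Higgs model, case (1): Lebesgue reference measure,
couplings `(β, κ, m)`. [cite: ShenZhuZhu2024Langevin, §2.1 case (1), §4.1] -/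
def rnLimitPoints (β κ m : ℝ) : Set (Measure (YMHConfig d N (EuclideanSpace ℝ (Fin N)))) :=
  ymhLimitPoints (d := d) volume rnAct rnSqDist rnMass β κ m

/-- Infinite-volume limit points of the `𝕊^{N−1}`-Higgs model, case (2): uniform sphere measure as
reference measure on `ℝ^N` (FLAG (S)), no mass term. [cite: ShenZhuZhu2024Langevin, §2.1 case (2), §4.2] -/
def sphereLimitPoints (β κ : ℝ) : Set (Measure (YMHConfig d N (EuclideanSpace ℝ (Fin N)))) :=
  ymhLimitPoints (d := d) (sphereRef N) rnAct rnSqDist (fun _ => 0) β κ 0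

/-- Infinite-volume limit points of the `G`-Higgs model, case (3): Haar reference measure, left
multiplication, Hilbert–Schmidt kinetic term, no mass term. [cite: ShenZhuZhu2024Langevin, §2.1 case (3), §4.2] -/
def grpLimitPoints (β κ : ℝ) :
    Set (Measure (YMHConfig d N (Matrix.specialOrthogonalGroup (Fin N) ℝ))) :=
  ymhLimitPoints (d := d) (haarProbability (Matrix.specialOrthogonalGroup (Fin N) ℝ)) grpAct grpSqDist
    (fun _ => 0) β κ 0

end ModelInstances

/-! ## §C Observables: Lipschitz cylinder functions, support distance, the clustering shape -/

section Observables

variable {d N : ℕ} {M : Type*}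

/-- A **Lipschitz cylinder observable** of the YMH configuration (FLAG (D)): `F` is a `K`-Lipschitz
function of the matrix entries of the links in `S` and of the coordinates `coord (Φ_x)`, `x ∈ T`
(sup metric on all coordinates) — the tree's rendering (`IsLipschitzCylinder`) of SZZ's smooth
cylinder functions with `⦀F⦀_∞ = Σ_e‖∇_eF‖_∞ + Σ_x‖∇_xF‖_∞ < ∞`.
[cite: ShenZhuZhu2024Langevin, §5.2 Theorem (the seminorm ⦀F⦀_∞)] -/
def IsYMHLipschitzCylinder {X : Type*} [PseudoEMetricSpace X] (coord : M → X)
    (F : YMHConfig d N M → ℝ) (S : Finset (ZdEdge d))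
    (T : Finset (Literature.Probability.LatticeModels.Site d)) (K : ℝ≥0) : Prop :=
  ∃ f : (↥S → Fin N → Fin N → ℝ) × (↥T → X) → ℝ, LipschitzWith K f ∧
    ∀ c : YMHConfig d N M,
      F c = f (fun e i j => (c.1 e : Matrix (Fin N) (Fin N) ℝ) i j, fun x => coord (c.2 x))

/-- The `ℓ^∞` distance between two finite sets of lattice sites (`0` if one is empty).
[cite: ShenZhuZhu2024Langevin, §5.1 (d(Λ_F, Λ_H))] -/
def siteSetDist (A B : Finset (Literature.Probability.LatticeModels.Site d)) : ℝ :=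
  if h : (A ×ˢ B).Nonempty then (A ×ˢ B).inf' h (fun p => ‖p.1 - p.2‖) else 0

/-- The sites carrying a support `(S, T)`: the base points of the links in `S` and the sites in `T`.
[cite: ShenZhuZhu2024Langevin, §5.1 (Λ_F)] -/
def ymhSupportSites (S : Finset (ZdEdge d)) (T : Finset (Literature.Probability.LatticeModels.Site d)) :
    Finset (Literature.Probability.LatticeModels.Site d) :=
  S.image Prod.fst ∪ T

/-- SZZ's separation `d(Λ_F, Λ_H)` of two supports, rendered as the `ℓ^∞` distance between their site
sets (FLAG (M)). [cite: ShenZhuZhu2024Langevin, §5.1 (d(Λ_F, Λ_H))] -/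
def ymhSupportDist (S₁ : Finset (ZdEdge d)) (T₁ : Finset (Literature.Probability.LatticeModels.Site d))
    (S₂ : Finset (ZdEdge d)) (T₂ : Finset (Literature.Probability.LatticeModels.Site d)) : ℝ :=
  siteSetDist (ymhSupportSites S₁ T₁) (ymhSupportSites S₂ T₂)

variable [MeasurableSpace M]

/-- **The mass-gap conclusion shape** of §5 for a measure `μ` on `YMHConfig d N M`, optionally
restricted to observables satisfying `P` (all observables: `P = fun _ => True`; gauge-invariant ones
in §5.3): there is a rate `c > 0` and for every support-size bound `n` a constant `c₁` such that for
bounded Lipschitz cylinder observables `F₁, F₂` with disjoint link supports and disjoint site supports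
(`Λ_{F₁} ∩ Λ_{F₂} = ∅`),
`|Cov_μ(F₁,F₂)| ≤ c₁ e^{−c d(Λ_{F₁},Λ_{F₂})} (K₁K₂ + ‖F₁‖_{L²(μ)}‖F₂‖_{L²(μ)})` (FLAGS (D), (M): the
printed `c₁(|Λ_F|,|Λ_H|,N)(d(𝔤)+N−1)` and `⦀·⦀` are absorbed into `c₁(n)` and the Lipschitz
constants). [cite: ShenZhuZhu2024Langevin, §5.1–§5.3 Theorems (mass gap), common conclusion] -/
def YMHClustersExp {X : Type*} [PseudoEMetricSpace X] (coord : M → X)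
    (P : (YMHConfig d N M → ℝ) → Prop) (μ : Measure (YMHConfig d N M)) : Prop :=
  ∃ c : ℝ, 0 < c ∧ ∀ n : ℕ, ∃ c₁ : ℝ,
    ∀ (F₁ F₂ : YMHConfig d N M → ℝ) (S₁ S₂ : Finset (ZdEdge d))
      (T₁ T₂ : Finset (Literature.Probability.LatticeModels.Site d)) (K₁ K₂ : ℝ≥0),
      P F₁ → P F₂ →
      S₁.card + T₁.card ≤ n → S₂.card + T₂.card ≤ n → Disjoint S₁ S₂ → Disjoint T₁ T₂ →
      IsYMHLipschitzCylinder coord F₁ S₁ T₁ K₁ → IsYMHLipschitzCylinder coord F₂ S₂ T₂ K₂ →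
      (∃ C, ∀ c, |F₁ c| ≤ C) → (∃ C, ∀ c, |F₂ c| ≤ C) →
        |cov[F₁, F₂; μ]| ≤ c₁ * Real.exp (-c * ymhSupportDist S₁ T₁ S₂ T₂) *
          ((K₁ : ℝ) * K₂ + Real.sqrt (∫ c, F₁ c ^ 2 ∂μ) * Real.sqrt (∫ c, F₂ c ^ 2 ∂μ))

/-- **The Wilson loop variable** `W_l = Tr(Q_{e₁}⋯Q_{e_n})` of the YMH configuration (links only),
`SO(N)` real trace ((2.x) "(de:wlo)"; = `(wilsonLoopTrace (specialOrthogonalRep _) w c.1).re`).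
[cite: ShenZhuZhu2024Langevin, §2.1 (Wilson loops, (de:wlo))] -/
def soWilsonLoopTrace {x : Literature.Probability.LatticeModels.Site d} (w : (zdGraph d).Walk x x)
    (c : YMHConfig d N M) : ℝ :=
  ((walkHolonomy c.1 w : Matrix.specialOrthogonalGroup (Fin N) ℝ) : Matrix (Fin N) (Fin N) ℝ).trace

/-- **The Wilson line variable** for `M = G`: `W_l = Tr(Φ_{u}ᵗ Q_{e₁}⋯Q_{e_n} Φ_v)` for an open
lattice path `l` from `u` to `v` ((2.x) "(de:wl)"). [cite: ShenZhuZhu2024Langevin, §2.1 (Wilson lines, (de:wl)), case (3)] -/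
def grpWilsonLine {u v : Literature.Probability.LatticeModels.Site d} (w : (zdGraph d).Walk u v)
    (c : YMHConfig d N (Matrix.specialOrthogonalGroup (Fin N) ℝ)) : ℝ :=
  (((c.2 u : Matrix.specialOrthogonalGroup (Fin N) ℝ) : Matrix (Fin N) (Fin N) ℝ).transpose *
      ((walkHolonomy c.1 w : Matrix.specialOrthogonalGroup (Fin N) ℝ) : Matrix (Fin N) (Fin N) ℝ) *
      ((c.2 v : Matrix.specialOrthogonalGroup (Fin N) ℝ) : Matrix (Fin N) (Fin N) ℝ)).trace

end Observables

/-! ### The U-gauge link measure of §5.3 (`M = G`) -/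

section UGauge

variable {d L N : ℕ}

/-- **The gauge-fixed action** `𝒮'(Q) = Nβ Σ_{p∈𝒫⁺} Re Tr Q_p + 2κN Σ_{e∈E⁺} Tr Q_e` of §5.3 — the
YMH action at the constant Higgs field `Φ ≡ Id` up to an additive constant:
`𝒮_YMH(Q, Id) = Nβ Σ_p Tr Q_p − Nκ Σ_e Tr((Q_e − I)(Q_e − I)ᵗ) = 𝒮'(Q) − 2κN²|E⁺|`.
[cite: ShenZhuZhu2024Langevin, §5.3 (gauge-fixed action 𝒮'_YMH = 𝒮₁' − 𝒮₂')] -/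
def uGaugeAction [NeZero L] (β κ : ℝ) (U : GaugeConfig d L (Matrix.specialOrthogonalGroup (Fin N) ℝ)) : ℝ :=
  N * β * ∑ p : Plaquette d L,
      ((plaquetteHolonomy U p.1 p.2.1.1 p.2.1.2 : Matrix.specialOrthogonalGroup (Fin N) ℝ) :
        Matrix (Fin N) (Fin N) ℝ).trace
    + 2 * κ * N * ∑ e : Edge d L, ((U e : Matrix.specialOrthogonalGroup (Fin N) ℝ) : Matrix (Fin N) (Fin N) ℝ).trace

/-- The un-normalised U-gauge weight `exp(𝒮'(Q)) Π_e dσ_N(Q_e)`. [cite: ShenZhuZhu2024Langevin, §5.3 (ν_Λ, (e:gauge-fix-nu))] -/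
def uGaugeWeight [NeZero L] (β κ : ℝ) : Measure (GaugeConfig d L (Matrix.specialOrthogonalGroup (Fin N) ℝ)) :=
  (Measure.pi fun _ : Edge d L => haarProbability (Matrix.specialOrthogonalGroup (Fin N) ℝ)).withDensity
    fun U => ENNReal.ofReal (Real.exp (uGaugeAction (N := N) β κ U))

/-- **The U-gauge link measure** `ν_Λ = Z⁻¹ exp(Nβ Σ_p Re Tr Q_p + 2κN Σ_e Tr Q_e) Π_e dσ_N(Q_e)` of
§5.3 on the torus — a Wilson lattice gauge theory perturbed by a single-link term.
[cite: ShenZhuZhu2024Langevin, §5.3 (ν_Λ, (e:gauge-fix-nu))] -/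
def uGaugeMeasure [NeZero L] (β κ : ℝ) : Measure (GaugeConfig d L (Matrix.specialOrthogonalGroup (Fin N) ℝ)) :=
  (uGaugeWeight (d := d) (L := L) (N := N) β κ Set.univ)⁻¹ • uGaugeWeight β κ

/-- Gauge transformation of a torus YMH configuration with `M = G`: `Q_e ↦ g_x Q_e g_y⁻¹` (tree
`gaugeTransform`), `Φ_x ↦ g_x Φ_x`. [cite: ShenZhuZhu2024Langevin, §2.1 and §5.3 (g · (Q,Φ))] -/
def grpGaugeTransformTorus (g : Site d L → Matrix.specialOrthogonalGroup (Fin N) ℝ)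
    (c : GaugeConfig d L (Matrix.specialOrthogonalGroup (Fin N) ℝ) ×
      (Site d L → Matrix.specialOrthogonalGroup (Fin N) ℝ)) :
    GaugeConfig d L (Matrix.specialOrthogonalGroup (Fin N) ℝ) ×
      (Site d L → Matrix.specialOrthogonalGroup (Fin N) ℝ) :=
  (gaugeTransform g c.1, fun x => g x * c.2 x)

end UGauge

/-! ## §D The theorems of the source as named facts -/

section Facts

/-- **§4.2 Corollary (uniqueness) — part of Theorem 1.3**, both compact targets. "Suppose that the
condition in Lemma [(KS-S)] for `Φ_x ∈ 𝕊^{N−1}` or the condition in Lemma [(KS-G)] for `Φ_x ∈ G` holds.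
The invariant measure `μ` for the infinite volume dynamics is unique … In particular, any infinite
volume limit of `μ_Λ` is `μ`." Typed as: for `d ≥ 2`, `N ≥ 3` and couplings `β, κ` for which some
`δ > 0` makes `szz24ConstSphere N d β κ δ > 0` (first conjunct, sphere model) resp.
`szz24ConstGroup N d β κ δ > 0` (second conjunct, `G`-model: left multiplication, Haar reference
measure), the model has AT MOST ONE infinite-volume limit point (the uniqueness of the invariant measure
of the dynamics and the log-Sobolev / `L^∞`-ergodicity clauses are not typed). Named fact, not proved
here. [cite: ShenZhuZhu2024Langevin, §4.2 Corollary (uniqueness; "any infinite volume limit of μ_Λ is μ") under (KS-S)/(KS-G); Thm 1.3] -/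
def szz24_uniqueness : Prop :=
  (∀ (d N : ℕ), 2 ≤ d → 3 ≤ N → ∀ β κ : ℝ, (∃ δ : ℝ, 0 < δ ∧ 0 < szz24ConstSphere N d β κ δ) →
    ∀ μ₁ ∈ sphereLimitPoints d N β κ, ∀ μ₂ ∈ sphereLimitPoints d N β κ, μ₁ = μ₂) ∧
  (∀ (d N : ℕ), 2 ≤ d → 3 ≤ N → ∀ β κ : ℝ, (∃ δ : ℝ, 0 < δ ∧ 0 < szz24ConstGroup N d β κ δ) →
    ∀ μ₁ ∈ grpLimitPoints d N β κ, ∀ μ₂ ∈ grpLimitPoints d N β κ, μ₁ = μ₂)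

/-- **§5.2 Theorem (mass gap for `M ∈ {𝕊^{N−1}, G}`) — Theorem 1.4, compact targets.** "Suppose
that `K_𝒮 > 0` in Lemma [(KS-S)] for `Φ_x ∈ 𝕊^{N−1}` or in Lemma [(KS-G)] for `Φ_x ∈ G`. For
`F, H ∈ C^∞_cyl(𝒬)`, suppose that `Λ_F ∩ Λ_H = ∅`. Then one has for the unique infinite volume limit `μ`
of `{μ_Λ}`: `|Cov_μ(F,H)| ≤ c₁ (d(𝔤)+N−1) e^{−c_N d(Λ_F,Λ_H)} (⦀F⦀_∞⦀H⦀_∞ + ‖F‖_{L²}‖H‖_{L²})`, where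
`c₁` depends on `|Λ_F|, |Λ_H|`, and `c_N` depends on `K_𝒮, N` and `d`." Typed in the Lipschitz
rendering (`YMHClustersExp`, FLAGS (D), (M), (S)) for every limit point (there is at most one,
`szz24_uniqueness`), `d ≥ 2`, `N ≥ 3`: first conjunct the sphere model under (KS-S), second the
`G`-model under (KS-G). Named fact, not proved here.
[cite: ShenZhuZhu2024Langevin, §5.2 Theorem (mass gap for M ∈ {𝕊^{N-1}, G}) under (KS-S)/(KS-G); Thm 1.4] -/
def szz24_massGap_compact : Prop :=
  (∀ (d N : ℕ), 2 ≤ d → 3 ≤ N → ∀ β κ : ℝ, (∃ δ : ℝ, 0 < δ ∧ 0 < szz24ConstSphere N d β κ δ) →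
    ∀ μ ∈ sphereLimitPoints d N β κ,
      YMHClustersExp (d := d) (N := N) (id : EuclideanSpace ℝ (Fin N) → EuclideanSpace ℝ (Fin N))
        (fun _ => True) μ) ∧
  (∀ (d N : ℕ), 2 ≤ d → 3 ≤ N → ∀ β κ : ℝ, (∃ δ : ℝ, 0 < δ ∧ 0 < szz24ConstGroup N d β κ δ) →
    ∀ μ ∈ grpLimitPoints d N β κ,
      YMHClustersExp (d := d) (N := N) (grpCoord (N := N)) (fun _ => True) μ)

/-- **§5.1 Theorem (mass gap), `M = ℝ^N` — Theorem 1.4 / the regime of Theorem 1.2.** "Let `m, κ > 0`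
and `K_𝒮 = (N+2)/4 − 1 − κN/m − 2κ²N/m² − 8(d−1)N|β| > 0`. For `F, H ∈ C^∞_cyl(𝒬)`, suppose that
`Λ_F ∩ Λ_H = ∅`. Let `μ` be an infinite volume limit of `μ_Λ`. Then one has
`|Cov_μ(F,H)| ≤ c₁ e^{−c_N d(Λ_F,Λ_H)} (⦀F⦀₂⦀H⦀₂ + ‖F‖_{L²}‖H‖_{L²})`, where `c₁` depends on
`|Λ_F|, |Λ_H|, N`, and `c_N` depends on `K_𝒮, N` and `d`." Typed in the (bounded) Lipschitz rendering
(`YMHClustersExp`; `⦀F⦀₂ ≤ ⦀F⦀_∞ ≤` Lipschitz data, FLAG (D)) for every limit point of the `ℝ^N`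
model, `d ≥ 2`, `N ≥ 3` (printed `N > 2`, §1). Named fact, not proved here.
[cite: ShenZhuZhu2024Langevin, §5.1 Theorem (mass gap for M = ℝ^N); Thm 1.4, Thm 1.2] -/
def szz24_massGap_rn : Prop :=
  ∀ (d N : ℕ), 2 ≤ d → 3 ≤ N → ∀ β κ m : ℝ, 0 < m → 0 < κ → 0 < szz24ConstRN N d β κ m →
    ∀ μ ∈ rnLimitPoints d N β κ m,
      YMHClustersExp (d := d) (N := N) (id : EuclideanSpace ℝ (Fin N) → EuclideanSpace ℝ (Fin N))
        (fun _ => True) μ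

/-- **§5.3 Lemma (U-gauge fixing on the torus), `M = G`.** "For any gauge invariant observable `h` on
`𝒬`, it holds that `𝐄_{μ_Λ}(h) = 𝐄_{ν_Λ}(h(·, Id))`", `ν_Λ` the link measure with density
`exp(Nβ Σ_p Re Tr Q_p + 2κN Σ_e Tr Q_e)` against product Haar measure (proof: the change of variables
`(Q,Φ) = g·(Q', Id)` with `g = Φ`, invariance of Haar measure, gauge invariance of `𝒮_YMH` and `h`).
Typed for bounded measurable gauge-invariant `h` on every torus `(ℤ/L)^d`, `L ≥ 1`, `N ≥ 3` (the
paper's standing `N > 2`; the identity itself is pure measure theory), all real `β, κ`. Named fact, not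
proved here. [cite: ShenZhuZhu2024Langevin, §5.3 Lemma (𝐄_{μ_Λ}(h) = 𝐄_{ν_Λ}(h(·, Id)))] -/
def szz24_uGauge_expectation : Prop :=
  ∀ (d L N : ℕ) [NeZero L], 3 ≤ N → ∀ (β κ : ℝ)
    (h : GaugeConfig d L (Matrix.specialOrthogonalGroup (Fin N) ℝ) ×
      (Site d L → Matrix.specialOrthogonalGroup (Fin N) ℝ) → ℝ),
    Measurable h → (∃ C, ∀ c, |h c| ≤ C) → (∀ g c, h (grpGaugeTransformTorus g c) = h c) →
      ∫ c, h c ∂(ymhMeasure (d := d) (L := L) (haarProbability (Matrix.specialOrthogonalGroup (Fin N) ℝ))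
          grpAct grpSqDist (fun _ => 0) β κ 0) =
        ∫ U, h (U, fun _ => 1) ∂(uGaugeMeasure (d := d) (L := L) (N := N) β κ)

/-- **§5.3 Corollary (mass gap for gauge-invariant observables under the improved condition), `M = G`.**
"Suppose that `K_{𝒮'} > 0` for `Φ_x ∈ G`. For gauge invariant observables `F, G ∈ C^∞_cyl(𝒬)`, suppose
that `Λ_F ∩ Λ_G = ∅`. Then one has for any infinite volume limit `μ` of `{μ_Λ}`:
`|Cov_μ(F,G)| ≤ c₁ (d(𝔤)+N−1) e^{−c_N d(Λ_F,Λ_G)} (⦀F⦀_∞⦀G⦀_∞ + ‖F‖_{L²}‖G‖_{L²})`."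
Typed in the Lipschitz rendering restricted to gauge-invariant observables (`IsYMHGaugeInvariant grpAct`),
for every limit point of the `G`-Higgs model, `d ≥ 2`, `N ≥ 3`, with `K_{𝒮'} = szz24ConstUGauge`.
Named fact, not proved here. [cite: ShenZhuZhu2024Langevin, §5.3 Corollary (mass gap under K_{𝒮'} > 0)] -/
def szz24_uGauge_massGap : Prop :=
  ∀ (d N : ℕ), 2 ≤ d → 3 ≤ N → ∀ β κ : ℝ, 0 < szz24ConstUGauge N d β κ →
    ∀ μ ∈ grpLimitPoints d N β κ,
      YMHClustersExp (d := d) (N := N) (grpCoord (N := N)) (IsYMHGaugeInvariant (d := d) grpAct) μ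

/-- **§6 Theorem (large `N` limit of gauge invariant observables), `M ∈ {𝕊^{N−1}, G}`, Wilson loops.**
"Assuming `K_𝒮 > 0` for `Φ_x ∈ 𝕊^{N−1}`, for every Wilson loop variable `W_l` and the unique infinite
volume limit `μ` …, one has `Var_μ(W_l/N) ≤ n(n−3)/(K_𝒮 N)`. Assuming `K_{𝒮'} > 0` for `Φ_x ∈ G`, for
every infinite volume limit `μ`, every Wilson loop or Wilson line variable `W_l`, one has
`Var_μ(W_l/N) ≤ n(n−3)/(K_{𝒮'} N)`." (`n` = number of edges; loops as in [ShenZhuZhuCMP2023]: closed,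
non-empty, no backtracking — tree `IsNonBacktrackingLoop`, so `n ≥ 4`; `W_l = Tr(Q_{e₁}⋯Q_{e_n})`,
`soWilsonLoopTrace`.) Typed: first conjunct — sphere model, every `δ > 0` with
`K_𝒮 = szz24ConstSphere N d β κ δ > 0`, every (i.e. the unique) limit point; second conjunct —
`G`-model, `K_{𝒮'} = szz24ConstUGauge N d β κ > 0`, every limit point, LOOPS only; `d ≥ 2`, `N ≥ 3`.
NOT typed — GAP-STATED: the Wilson-LINE clause as printed, because for open lines with `n ≤ 3` edges the
printed right-hand side `n(n−3)/(K_{𝒮'}N)` is `≤ 0` while `W_l/N = Tr(Φ_uᵗ Q_{e₁}⋯Q_{e_n} Φ_v)/N` is not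
a.s. constant, so the display cannot be transcribed literally for all lines (the `−3` is the loop count
`A(e)+B(e) ≤ n−3` of [ShenZhuZhuCMP2023] §4.2; the object `grpWilsonLine` is defined above for a later
corrected statement). The printed consequences (convergence in probability, factorisation as `N → ∞`)
are not part of this fact either. Named fact, not proved here.
[cite: ShenZhuZhu2024Langevin, §6 Theorem (large N limit), (e:varW)–(e:varWG), loop cases] -/
def szz24_largeN_variance : Prop :=
  (∀ (d N : ℕ), 2 ≤ d → 3 ≤ N → ∀ β κ δ : ℝ, 0 < δ → 0 < szz24ConstSphere N d β κ δ →
    ∀ μ ∈ sphereLimitPoints d N β κ,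
      ∀ (x : Literature.Probability.LatticeModels.Site d) (w : (zdGraph d).Walk x x), IsNonBacktrackingLoop w →
        Var[fun c => soWilsonLoopTrace w c / N; μ] ≤
          (w.length : ℝ) * ((w.length : ℝ) - 3) / (szz24ConstSphere N d β κ δ * N)) ∧
  (∀ (d N : ℕ), 2 ≤ d → 3 ≤ N → ∀ β κ : ℝ, 0 < szz24ConstUGauge N d β κ →
    ∀ μ ∈ grpLimitPoints d N β κ,
      ∀ (x : Literature.Probability.LatticeModels.Site d) (w : (zdGraph d).Walk x x), IsNonBacktrackingLoop w →
        Var[fun c => soWilsonLoopTrace w c / N; μ] ≤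
          (w.length : ℝ) * ((w.length : ℝ) - 3) / (szz24ConstUGauge N d β κ * N))

end Facts

end Literature.MathematicalPhysics.QuantumFieldTheory
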